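import Summits.CriticalPhenomena.CardyFormulaZ2.Theorems.CardyComplexConeParafermionToSLESixFamiliesDiamondDartPhaseCount
import Summits.CriticalPhenomena.CardyFormulaZ2.Theorems.CardyComplexConeParafermionToSLESixFamiliesDiamondDartPhaseLoop
import HarnessLib

/-!
# The dart class relative to the mark, the mark count, and the phase algebra of `BoundaryDartPhase`
# (line `potential-darboux-picard-diamond`, S1p `stub_boundaryDartPhase`, part 9)

Crux `ParafermionToSLESixFamilies` (stmt-CriticalPhenomena-11389), line `potential-darboux-picard-diamond`, stub
`stub_boundaryDartPhase` (S1p). The lattice theorem (`turnCount_freeDart`, `turnCount_wiredDart`) gives the turn count at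
a boundary dart of side `k` as `T = T⋆ + dartClass k k⋆ (Gk k⋆ a) sp`, the class being read relative to the side `k⋆` beyond
which the outer corner `p⋆` of the start edge lies. Here:

* `kp_cases` — `k⋆` is the side `kₐ` of the mark `a = dParam kₐ σ` at the start edge, or an adjacent side with `a` within
  `2ε'` of the common corner;
* `dartClass_eq_markClass` — for a segment of length `> 2ε'` missing `a` in its interior the class relative to `k⋆` is the
  class relative to `kₐ` (`dartClass k kₐ (σ - gam' kₐ) sp`) shifted by `0, -1, +1` in the three cases;
* `sub_markClass_eq` — `k - dartClass k kₐ (σ - gam') sp = kₐ - 4 + 4·[dPos a ≤ dPos p]` (boundary positions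
  `dLo kₐ + σ`, `dLo k + sp` of `…DiamondTracePos.lean`): the class counts the diamond corners counter-clockwise from the mark;
* `cycInd_of_reps` — the cyclic order of three loop parameters is read off their representatives in a period window;
* `exp_pi_div_six_of_modEq`, `dartPhase_eq` (registered) — the phase algebra: with `T = T⋆ + s`, `k - s = kₐ - 4 + 4[A ≤ P]`,
  `m = [A ≤ P] + [B ≤ P]` and the orientation relation `[A ≤ P] - [B ≤ P] = [A < B] - [wired]`, the passage phase
  `exp(-iπT/6)·i^{(k+2).val}·exp(∓iπ/6)` equals `exp(iπ(-T⋆ + kₐ + 1 + 2[A < B])/6) · exp(iπ(k + m)/3)`.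
-/

noncomputable section

namespace Summit.CriticalPhenomena.CardyFormulaZ2.Cruxes.ParafermionToSLESixFamilies.PotentialDarbouxPicardDiamond

open Set Metric Complex
open Literature.Probability.RandomPlanarGeometry

/-! ## The side of `p⋆` versus the side of the mark -/

section Mark

variable {c : ℂ} {α β : ℝ} (hα : 0 < α) (hβ : 0 < β) {a : ℂ} {ka : Fin 4} {σ : ℝ} (hσ0 : 0 ≤ σ) (hσ1 : σ < dLen α β ka)
  (ha : dRot c a = dParam α β ka σ) {P : ℂ} {ε' : ℝ} (hε' : 2 * ε' < min α β)
  (hPa : ∀ k : Fin 4, |Fk k P - Fk k (dRot c a)| ≤ ε') {kp : Fin 4} (hkp : gam α β kp ≤ Fk kp P)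

include hα hβ hσ0 hσ1 ha hε' hPa hkp in
/-- **The side beyond which `p⋆` lies is the side of the mark or adjacent to it**, and in the adjacent cases the mark is
within `2ε'` of the common corner. -/
theorem kp_cases : kp = ka ∨ (kp = ka + 1 ∧ dLen α β ka - 2 * ε' ≤ σ) ∨ (kp = ka + 3 ∧ σ ≤ 2 * ε') := by
  have hF : gam α β kp - ε' ≤ Fk kp (dRot c a) := by
    have := abs_le.1 (hPa kp); linarith
  rw [ha] at hF
  obtain ⟨r, hr⟩ := exists_eq_add ka kp
  have hga := Fk_dParam α β ka σ
  have hGa := Gk_dParam α β ka σ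
  obtain ⟨hF1, hG1⟩ := Fk_succ ka (dParam α β ka σ)
  obtain ⟨hF2, -⟩ := Fk_add_two ka (dParam α β ka σ)
  obtain ⟨hF3, -⟩ := Fk_add_three ka (dParam α β ka σ)
  obtain ⟨hg1, hg1', hg2, -, hg3, -⟩ := gam_succ α β ka
  have hmin := min_le_gam α β ka
  have hmin' := min_le_gam α β (ka + 1)
  have hL := dLen_eq α β ka
  have hgp : 0 < gam α β ka := lt_of_lt_of_le (lt_min hα hβ) hmin
  fin_cases r
  · left; simpa using hr
  · right; left
    simp only [Fin.mk_one] at hr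
    subst hr
    refine ⟨rfl, ?_⟩
    rw [hF1, hGa, hg1] at hF
    linarith
  · exfalso
    simp only [Fin.reduceFinMk] at hr
    subst hr
    rw [hF2, hga, hg2] at hF
    linarith
  · right; right
    simp only [Fin.reduceFinMk] at hr
    subst hr
    refine ⟨rfl, ?_⟩
    rw [hF3, hGa, hg3] at hF
    linarith

include hα hβ hσ0 hσ1 ha hε' hPa hkp in
/-- **The dart class relative to `k⋆` is the class relative to the side of the mark, up to a constant shift.** For a
segment `[sp, sq]` of side `k` longer than `2ε'` with the mark off its interior (`σ ∉ (sp, sq)` if `k = kₐ`). -/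
theorem dartClass_eq_markClass {k : Fin 4} {sp sq : ℝ} (hsp0 : 0 ≤ sp) (hsqL : sq ≤ dLen α β k) (hlen : 2 * ε' < sq - sp)
    (hoff : k = ka → σ ≤ sp ∨ sq ≤ σ) :
    (kp = ka ∧ dartClass α β k kp (Gk kp (dRot c a)) sp = dartClass α β k ka (σ - gam' α β ka) sp) ∨
    (kp = ka + 1 ∧ dartClass α β k kp (Gk kp (dRot c a)) sp = dartClass α β k ka (σ - gam' α β ka) sp - 1) ∨
    (kp = ka + 3 ∧ dartClass α β k kp (Gk kp (dRot c a)) sp = dartClass α β k ka (σ - gam' α β ka) sp + 1) := by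
  have hGa := Gk_dParam α β ka σ
  have hga := Fk_dParam α β ka σ
  obtain ⟨-, hG1⟩ := Fk_succ ka (dParam α β ka σ)
  obtain ⟨-, hG3⟩ := Fk_add_three ka (dParam α β ka σ)
  obtain ⟨hg1, hg1', -, -, hg3, hg3'⟩ := gam_succ α β ka
  have hne1 : ∀ ka : Fin 4, ka + 1 ≠ ka ∧ ka + 3 ≠ ka ∧ ka ≠ ka + 1 ∧ ka ≠ ka + 3 := by decide
  have hL := dLen_eq α β ka
  have hgp : 0 < gam α β ka := lt_of_lt_of_le (lt_min hα hβ) (min_le_gam α β ka)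
  rcases kp_cases hα hβ hσ0 hσ1 ha hε' hPa hkp with rfl | ⟨rfl, hσ⟩ | ⟨rfl, hσ⟩
  · left; refine ⟨rfl, ?_⟩; rw [ha, hGa]
  · right; left; refine ⟨rfl, ?_⟩
    rw [ha, hG1, hga]
    obtain ⟨r, hr⟩ := exists_eq_add ka k
    fin_cases r
    · simp only [Fin.zero_eta, add_zero] at hr; subst hr
      have hsq : sq ≤ 2 * gam' α β k := by rw [← dLen_eq]; exact hsqL
      rcases hoff rfl with h | h
      · exfalso; linarith
      · rw [dartClass, dartClass, if_neg (hne1 k).2.2.1, if_pos rfl, if_neg (by linarith)]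
        have : ∀ k : Fin 4, ((k - (k + 1)).val : ℕ) = 3 := by decide
        rw [this]; norm_num
    · simp only [Fin.mk_one] at hr; subst hr
      rw [dartClass, dartClass, if_pos rfl, if_neg (hne1 ka).1, if_pos (by linarith)]
      have : ∀ k : Fin 4, ((k + 1 - k).val : ℕ) = 1 := by decide
      rw [this]; norm_num
    · simp only [Fin.reduceFinMk] at hr; subst hr
      have e : ∀ k : Fin 4, k + 2 ≠ k + 1 ∧ k + 2 ≠ k ∧ ((k + 2 - (k + 1)).val : ℕ) = 1 ∧ ((k + 2 - k).val : ℕ) = 2 := by decide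
      rw [dartClass, dartClass, if_neg (e ka).1, if_neg (e ka).2.1, (e ka).2.2.1, (e ka).2.2.2]; norm_num
    · simp only [Fin.reduceFinMk] at hr; subst hr
      have e : ∀ k : Fin 4, k + 3 ≠ k + 1 ∧ k + 3 ≠ k ∧ ((k + 3 - (k + 1)).val : ℕ) = 2 ∧ ((k + 3 - k).val : ℕ) = 3 := by decide
      rw [dartClass, dartClass, if_neg (e ka).1, if_neg (e ka).2.1, (e ka).2.2.1, (e ka).2.2.2]; norm_num
  · right; right; refine ⟨rfl, ?_⟩
    rw [ha, hG3, hga]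
    obtain ⟨r, hr⟩ := exists_eq_add ka k
    fin_cases r
    · simp only [Fin.zero_eta, add_zero] at hr; subst hr
      rcases hoff rfl with h | h
      · rw [dartClass, dartClass, if_neg (hne1 k).2.2.2, if_pos rfl, if_pos (by linarith)]
        have : ∀ k : Fin 4, ((k - (k + 3)).val : ℕ) = 1 := by decide
        rw [this]; norm_num
      · exfalso; linarith
    · simp only [Fin.mk_one] at hr; subst hr
      have e : ∀ k : Fin 4, k + 1 ≠ k + 3 ∧ k + 1 ≠ k ∧ ((k + 1 - (k + 3)).val : ℕ) = 2 ∧ ((k + 1 - k).val : ℕ) = 1 := by decide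
      rw [dartClass, dartClass, if_neg (e ka).1, if_neg (e ka).2.1, (e ka).2.2.1, (e ka).2.2.2]; norm_num
    · simp only [Fin.reduceFinMk] at hr; subst hr
      have e : ∀ k : Fin 4, k + 2 ≠ k + 3 ∧ k + 2 ≠ k ∧ ((k + 2 - (k + 3)).val : ℕ) = 3 ∧ ((k + 2 - k).val : ℕ) = 2 := by decide
      rw [dartClass, dartClass, if_neg (e ka).1, if_neg (e ka).2.1, (e ka).2.2.1, (e ka).2.2.2]; norm_num
    · simp only [Fin.reduceFinMk] at hr; subst hr
      have hsq : sq ≤ 2 * gam' α β (ka + 3) := by rw [← dLen_eq]; exact hsqL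
      have hsp : sp < dLen α β (ka + 3) := by linarith [dLen_eq α β (ka + 3)]
      rw [dartClass, dartClass, if_pos rfl, if_neg (hne1 ka).2.1, if_neg (by rw [dLen_eq, hg3'] at hsp; linarith)]
      have : ∀ k : Fin 4, ((k + 3 - k).val : ℕ) = 3 := by decide
      rw [this]; norm_num

end Mark

/-! ## The class relative to the mark counts corners from the mark -/

/-- **`k - class = kₐ - 4 + 4·[A ≤ P]`** with the boundary positions `A = dLo kₐ + σ` of the mark and `P = dLo k + sp` of
the segment start. -/
theorem sub_markClass_eq {α β : ℝ} (hα : 0 < α) (hβ : 0 < β) (k ka : Fin 4) {σ sp : ℝ} (hσ0 : 0 ≤ σ) (hσ1 : σ < dLen α β ka)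
    (hsp0 : 0 ≤ sp) (hsp1 : sp < dLen α β k) :
    (k.val : ℤ) - dartClass α β k ka (σ - gam' α β ka) sp =
      (ka.val : ℤ) - 4 + 4 * (if dLo α β ka + σ ≤ dLo α β k + sp then 1 else 0) := by
  have hB : 0 < dBlock α β := by unfold dBlock; linarith
  have hLa := dLen_lt_dBlock hα hβ ka
  have hLk := dLen_lt_dBlock hα hβ k
  rw [dLo_eq_mul, dLo_eq_mul]
  by_cases hk : k = ka
  · subst hk
    rw [dartClass, if_pos rfl]
    by_cases h : σ ≤ sp
    · rw [if_pos (by linarith), if_pos (by linarith)]; ring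
    · rw [if_neg (by linarith), if_neg (by linarith)]; ring
  · rw [dartClass, if_neg hk]
    have hkv : k.val ≠ ka.val := fun h => hk (Fin.ext h)
    rcases Nat.lt_or_gt_of_ne hkv with hlt | hlt
    · have hval : ((k - ka).val : ℤ) = k.val + 4 - ka.val := by
        have h1 : k.val < 4 := k.isLt
        rw [Fin.coe_sub_iff_lt.2 hlt]; omega
      have hlt' : (k.val : ℝ) + 1 ≤ ka.val := by exact_mod_cast hlt
      rw [hval, if_neg (by nlinarith [mul_le_mul_of_nonneg_right hlt' hB.le])]; push_cast; ring
    · have hval : ((k - ka).val : ℤ) = k.val - ka.val := by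
        rw [Fin.coe_sub_iff_le.2 hlt.le]; omega
      have hlt' : (ka.val : ℝ) + 1 ≤ k.val := by exact_mod_cast hlt
      rw [hval, if_pos (by nlinarith [mul_le_mul_of_nonneg_right hlt' hB.le])]; ring

/-! ## Cyclic order from window representatives -/

/-- An integer `d` with `|t + 2π d| < 2π` for `t ∈ (-2π, 0)` is `0` or `1`. -/
theorem int_eq_zero_or_one_of_window {t : ℝ} {d : ℤ} (ht1 : -(2 * Real.pi) < t) (ht2 : t < 0)
    (h1 : -(2 * Real.pi) < t + d * (2 * Real.pi)) (h2 : t + d * (2 * Real.pi) < 2 * Real.pi) : d = 0 ∨ d = 1 := by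
  have hπ := Real.two_pi_pos
  have hd1 : (-1 : ℝ) < d := by nlinarith
  have hd2 : (d : ℝ) < 2 := by nlinarith
  have hd1' : (-1 : ℤ) < d := by exact_mod_cast hd1
  have hd2' : d < 2 := by exact_mod_cast hd2
  omega

/-- **The cyclic order of three loop parameters is read off their window representatives**: for `x < y < z < x + 2π`
and representatives `x', y', z'` in one period window, `[x' ≤ y'] - [z' ≤ y'] = [x' < z']`. -/
theorem cycInd_of_reps {x y z L : ℝ} (hxy : x < y) (hyz : y < z) (hzx : z < x + 2 * Real.pi) {x' y' z' : ℝ}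
    (hx' : x' ∈ Ico L (L + 2 * Real.pi)) (hy' : y' ∈ Ico L (L + 2 * Real.pi)) (hz' : z' ∈ Ico L (L + 2 * Real.pi))
    {a b e : ℤ} (hxa : x' = x + a * (2 * Real.pi)) (hyb : y' = y + b * (2 * Real.pi)) (hze : z' = z + e * (2 * Real.pi)) :
    ((if x' ≤ y' then 1 else 0 : ℤ) - (if z' ≤ y' then 1 else 0 : ℤ)) = (if x' < z' then 1 else 0 : ℤ) := by
  have hπ := Real.two_pi_pos
  have hab : a - b = 0 ∨ a - b = 1 := by
    refine int_eq_zero_or_one_of_window (t := x - y) (d := a - b) (by linarith) (by linarith) ?_ ?_ <;>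
      push_cast <;> nlinarith [hx'.1, hx'.2, hy'.1, hy'.2]
  have hbe : b - e = 0 ∨ b - e = 1 := by
    refine int_eq_zero_or_one_of_window (t := y - z) (d := b - e) (by linarith) (by linarith) ?_ ?_ <;>
      push_cast <;> nlinarith [hy'.1, hy'.2, hz'.1, hz'.2]
  have hae : a - e = 0 ∨ a - e = 1 := by
    refine int_eq_zero_or_one_of_window (t := x - z) (d := a - e) (by linarith) (by linarith) ?_ ?_ <;>
      push_cast <;> nlinarith [hx'.1, hx'.2, hz'.1, hz'.2]
  rcases hab with hab | hab <;> rcases hbe with hbe | hbe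
  · have ha : (a : ℝ) = b := by exact_mod_cast (by omega : a = b)
    have he : (e : ℝ) = b := by exact_mod_cast (by omega : e = b)
    rw [if_pos (by rw [hxa, hyb, ha]; linarith), if_neg (by rw [hze, hyb, he]; linarith),
      if_pos (by rw [hxa, hze, ha, he]; linarith)]; norm_num
  · have ha : (a : ℝ) = b := by exact_mod_cast (by omega : a = b)
    have he : (e : ℝ) = b - 1 := by
      have : e = b - 1 := by omega
      rw [this]; push_cast; ring
    rw [if_pos (by rw [hxa, hyb, ha]; linarith), if_pos (by rw [hze, hyb, he]; nlinarith),
      if_neg (by rw [hxa, hze, ha, he]; nlinarith)]; norm_num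
  · have ha : (a : ℝ) = b + 1 := by
      have : a = b + 1 := by omega
      rw [this]; push_cast; ring
    have he : (e : ℝ) = b := by exact_mod_cast (by omega : e = b)
    rw [if_neg (by rw [hxa, hyb, ha]; nlinarith), if_neg (by rw [hze, hyb, he]; linarith),
      if_neg (by rw [hxa, hze, ha, he]; nlinarith)]; norm_num
  · exfalso
    rcases hae with hae | hae <;> omega

/-! ## The phase algebra -/

/-- `exp(iπ n/6)` only depends on `n mod 12`. -/
theorem exp_pi_div_six_of_modEq {a b : ℤ} (h : ∃ z : ℤ, a = b + 12 * z) :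
    Complex.exp ((Real.pi / 6 * a : ℝ) * I) = Complex.exp ((Real.pi / 6 * b : ℝ) * I) := by
  obtain ⟨z, rfl⟩ := h
  push_cast
  rw [show (Real.pi : ℂ) / 6 * (b + 12 * z) * I = Real.pi / 6 * b * I + z * (2 * Real.pi * I) by ring, Complex.exp_add,
    Complex.exp_int_mul_two_pi_mul_I, mul_one]

/-- Powers of `i` as phases: `i ^ n = exp(iπ·3n/6)`. -/
theorem I_pow_eq_exp (n : ℕ) : (I : ℂ) ^ n = Complex.exp ((Real.pi / 6 * (3 * n : ℤ) : ℝ) * I) := by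
  have hI : I = Complex.exp (Real.pi / 2 * I) := Complex.exp_pi_div_two_mul_I.symm
  conv_lhs => rw [hI, ← Complex.exp_nat_mul]
  congr 1
  push_cast; ring

/-- **The phase algebra of `BoundaryDartPhase`** (registered helper of `stub_boundaryDartPhase`). Let `T = T⋆ + s` be the
turn count at a dart of side `k` (orientation `k + 2`), `k - s = kₐ - 4 + 4·iA`, `m = iA + iB` the mark count, `w ∈ {0, 1}`
the wired indicator and `iA - iB = iAB - w` the orientation relation (`iA, iB, iAB` the indicators `[A ≤ P]`, `[B ≤ P]`,
`[A < B]`). Then `exp(-iπT/6)·i^{(k+2).val}·exp((2w-1)iπ/6) = exp(iπ(-T⋆ + kₐ + 1 + 2 iAB)/6)·exp(iπ(k + m)/3)`. -/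
theorem dartPhase_eq : ∀ (T Ts s iA iB iAB w : ℤ) (k ka : Fin 4) (m : ℕ), T = Ts + s → (k.val : ℤ) - s = (ka.val : ℤ) - 4 + 4 * iA → (m : ℤ) = iA + iB → iA - iB = iAB - w → Complex.exp (-(Real.pi / 6 * T : ℝ) * I) * I ^ ((k + 2 : Fin 4) : ℕ) * Complex.exp (((2 * w - 1 : ℤ) * (Real.pi / 6) : ℝ) * I) = Complex.exp ((Real.pi / 6 * (-Ts + ka.val + 1 + 2 * iAB : ℤ) : ℝ) * I) * Complex.exp (((Real.pi / 3 * ((k.val : ℝ) + (m : ℝ))) : ℝ) * I) := by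
  intro T Ts s iA iB iAB w k ka m hT hks hm hor
  have hk2 : ((k + 2 : Fin 4) : ℕ) = (k.val + 2) % 4 := by
    rw [Fin.val_add]; simp
  rw [I_pow_eq_exp, hk2]
  have e1 : Complex.exp (-(Real.pi / 6 * T : ℝ) * I) = Complex.exp ((Real.pi / 6 * (-T : ℤ) : ℝ) * I) := by
    congr 1; push_cast; ring
  have e2 : Complex.exp (((2 * w - 1 : ℤ) * (Real.pi / 6) : ℝ) * I) = Complex.exp ((Real.pi / 6 * (2 * w - 1 : ℤ) : ℝ) * I) := by
    congr 1; push_cast; ring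
  have e3 : Complex.exp (((Real.pi / 3 * ((k.val : ℝ) + (m : ℝ))) : ℝ) * I) =
      Complex.exp ((Real.pi / 6 * (2 * (k.val : ℤ) + 2 * (m : ℤ) : ℤ) : ℝ) * I) := by
    congr 1; push_cast; ring
  rw [e1, e2, e3, ← Complex.exp_add, ← Complex.exp_add, ← Complex.exp_add]
  have lhs : ((Real.pi / 6 * ((-T : ℤ) : ℝ) : ℝ) : ℂ) * I + ((Real.pi / 6 * ((3 * ((k.val + 2) % 4 : ℕ) : ℤ) : ℝ) : ℝ) : ℂ) * I +
      ((Real.pi / 6 * ((2 * w - 1 : ℤ) : ℝ) : ℝ) : ℂ) * I =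
      ((Real.pi / 6 * ((-T + 3 * ((k.val + 2) % 4 : ℕ) + (2 * w - 1) : ℤ) : ℝ) : ℝ) : ℂ) * I := by
    push_cast; ring
  have rhs : ((Real.pi / 6 * ((-Ts + ka.val + 1 + 2 * iAB : ℤ) : ℝ) : ℝ) : ℂ) * I +
      ((Real.pi / 6 * ((2 * (k.val : ℤ) + 2 * (m : ℤ) : ℤ) : ℝ) : ℝ) : ℂ) * I =
      ((Real.pi / 6 * ((-Ts + ka.val + 1 + 2 * iAB + (2 * k.val + 2 * m) : ℤ) : ℝ) : ℝ) : ℂ) * I := by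
    push_cast; ring
  rw [lhs, rhs]
  apply exp_pi_div_six_of_modEq
  have h4 : k.val < 4 := k.isLt
  refine ⟨(-(T - Ts) + 3 * (((k.val + 2) % 4 : ℕ) : ℤ) + 2 * w - 2 - ka.val - 2 * iAB - 2 * k.val - 2 * m) / 12, ?_⟩
  push_cast
  omega

end Summit.CriticalPhenomena.CardyFormulaZ2.Cruxes.ParafermionToSLESixFamilies.PotentialDarbouxPicardDiamond

end
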